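import Summits.QuantumFields.YangMills.Theorems.BalabanLadderUVSeamRecCarrierExpMomentsGlue
import HarnessLib

/-!
# Crux `UVSeamRec` (stmt-QuantumFields-20043), line `coldwall_pure`: the bare-weighted carrier binders DIE on an unbounded carrier mean

Helper file (`--supports stmt-QuantumFields-20043`) of the LEAD seat `ym-spine-20043-p1` (gen 18); companion of `…CarrierFlatGlue` (kill criterion of the bare-weighted binders).

Both (β)-architecture binders of the second measure-side slot — tempered-d1's `GaussianDominationSU2` (the registered `stub_gaussianDomination` of
`Lines/coldwall_pure.lean`, RESHAPE 2) and the RESHAPE-3 candidate `CarrierExpMomentsSU2` — bound the torus MEAN of the bare-weighted classical carrier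
`carrierCl 1 1 β R = β·R⁴·cr` by a β-UNIFORM constant on the whole femto window `R·uRec β ≤ ℓ₁` (`torusE_carrierCl_le_of_emLin`, LEAD g16;
`torusE_carrierCl_le_of_carrierExpMoments`, LEAD g17).  This file records the converse as the KILL CRITERION of both binders:

* `not_gaussianDominationSU2_of_carrierMean_unbounded`, `not_carrierExpMomentsSU2_of_carrierMean_unbounded` — if at EVERY physical size `ℓ > 0`
  the torus mean `⟨carrierCl 1 1 β R q x⟩_{2L+1,β}` is unbounded along admissible `(β, R, L, q, x)` with `R·uRec β ≤ ℓ` (hypothesis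
  `CarrierMeanUnbounded`, stated inline), then `¬ GaussianDominationSU2` and `¬ CarrierExpMomentsSU2`;
* `carrierMean_eq_mul_flat` — `⟨carrierCl 1 1 β R⟩ = β·⟨carrierCl 1 1 1 R⟩`: the criterion reads «`β·⟨R⁴cr⟩` unbounded at fixed physical size».

WHY THE CRITERION IS EXPECTED TO BITE (heuristic, not kernel content; memo `FINDING-20043-g18-running-coupling.md`): under the torus state the slow
modes at scale `R` carry the RUNNING coupling, `⟨R⁴·cr⟩ ≍ κ·g²(R)` with `1/g²(R) = β/2 − 2b₀ log R` (one loop, `g₀² = 2/β`), so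
`⟨carrierCl 1 1 β R⟩ = β⟨R⁴cr⟩ ≍ 2κ·g²(R)/g₀²`, which at `R·uRec β = ℓ` equals `κ·β·g²_phys(ℓ) → ∞` (`uRec` = the two-loop lattice unit `aΛ_L`).
The bare lattice Gaussian calibration of the binders (`√β R²·|F_h(centre)| = O(1)`) misses exactly this factor `g²(R)/g₀²`.  The β-free carrier
`carrierCl C 1 1 R` of `…CarrierFlatGlue` is the repair.

HONEST FRAMING: two elementary implications between named conditional binders and an inline hypothesis; the hypothesis itself (growth of the
carrier mean = a non-triviality-type statement) is NOT proved here; nothing of E0′, NT or the gap; YM mass gap NOT proved; not Clay.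
-/

noncomputable section

open MeasureTheory Filter Topology Finset
open Literature.MathematicalPhysics.QuantumFieldTheory (GaugeConfig LatticeRep)
open Literature.MathematicalPhysics.QuantumLattice (fundamentalRep fundamentalLatticeRep LGConfig)
open Summit.QuantumFields.YangMills.Cruxes.OSLegsFromFemtoAndGap.DlrCollarTransfer
open Summit.QuantumFields.YangMills.Cruxes.UVSeamRec
open Summit.QuantumFields.YangMills.Cruxes.UVSeamRec.ResponsePinning (torusE_const_mul')

namespace Summit.QuantumFields.YangMills.Cruxes.UVSeamRec.ClassicalResponse

/-- `⟨carrierCl 1 1 β R q x⟩_{2L+1,β} = β · ⟨carrierCl 1 1 1 R q x⟩_{2L+1,β}`: the bare-weighted carrier mean is `β` times the flat one. [folklore] -/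
theorem carrierMean_eq_mul_flat (β : ℝ) (L R : ℕ) (q : Fin 4 × Fin 4) (x : Fin 4 → ℤ) :
    torusE (Matrix.specialUnitaryGroup (Fin 2) ℂ) (fundamentalLatticeRep 2) β L (carrierCl (fundamentalLatticeRep 2) 1 1 β R q x) =
      β * torusE (Matrix.specialUnitaryGroup (Fin 2) ℂ) (fundamentalLatticeRep 2) β L (carrierCl (fundamentalLatticeRep 2) 1 1 1 R q x) := by
  have e : carrierCl (fundamentalLatticeRep 2) 1 1 β R q x =
      fun U => β * carrierCl (fundamentalLatticeRep 2) 1 1 1 R q x U := by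
    funext U
    unfold carrierCl
    ring
  rw [e, torusE_const_mul']

/-- **KILL CRITERION FOR (GD).**  If at every physical size `ℓ > 0` the torus mean of the bare-weighted carrier `carrierCl 1 1 β R` is unbounded
along admissible data (`β` beyond any threshold, `1 ≤ R`, `R·uRec β ≤ ℓ`, `4R+8 ≤ L`, `q.1 < q.2`), then `GaussianDominationSU2` is false
(it bounds that mean by `2e^{m₁+v₁/2}`, `torusE_carrierCl_le_of_emLin`). [folklore] -/
theorem not_gaussianDominationSU2_of_carrierMean_unbounded
    (hU : ∀ ℓ : ℝ, 0 < ℓ → ∀ M β₀ : ℝ, ∃ β : ℝ, β₀ ≤ β ∧ ∃ (L R : ℕ) (q : Fin 4 × Fin 4) (x : Fin 4 → ℤ),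
      q.1 < q.2 ∧ 1 ≤ R ∧ (R : ℝ) * Transport.uRec β ≤ ℓ ∧ 4 * R + 8 ≤ L ∧
      M < torusE (Matrix.specialUnitaryGroup (Fin 2) ℂ) (fundamentalLatticeRep 2) β L
        (carrierCl (fundamentalLatticeRep 2) 1 1 β R q x)) :
    ¬ GaussianDominationSU2 := by
  rintro ⟨m₁, v₁, β₁, ℓ₁, hℓ₁, hEM⟩
  obtain ⟨β, hβ, L, R, q, x, hq, hR, hRu, hRL, hM⟩ := hU ℓ₁ hℓ₁ (2 * Real.exp (m₁ + v₁ / 2)) (max β₁ 0)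
  have h := torusE_carrierCl_le_of_emLin one_pos hEM ((le_max_left _ _).trans hβ) ((le_max_right _ _).trans hβ) q x hq hR hRu hRL
  linarith

/-- **KILL CRITERION FOR (EM_Q^∃).**  Under the same unboundedness, `CarrierExpMomentsSU2` is false (it bounds the mean by `C·B/2`,
`torusE_carrierCl_le_of_carrierExpMoments`). [folklore] -/
theorem not_carrierExpMomentsSU2_of_carrierMean_unbounded
    (hU : ∀ ℓ : ℝ, 0 < ℓ → ∀ M β₀ : ℝ, ∃ β : ℝ, β₀ ≤ β ∧ ∃ (L R : ℕ) (q : Fin 4 × Fin 4) (x : Fin 4 → ℤ),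
      q.1 < q.2 ∧ 1 ≤ R ∧ (R : ℝ) * Transport.uRec β ≤ ℓ ∧ 4 * R + 8 ≤ L ∧
      M < torusE (Matrix.specialUnitaryGroup (Fin 2) ℂ) (fundamentalLatticeRep 2) β L
        (carrierCl (fundamentalLatticeRep 2) 1 1 β R q x)) :
    ¬ CarrierExpMomentsSU2 := by
  rintro ⟨C, B, β₁, ℓ₁, hC, hℓ₁, hCE⟩
  obtain ⟨β, hβ, L, R, q, x, hq, hR, hRu, hRL, hM⟩ := hU ℓ₁ hℓ₁ (C * B / 2) (max β₁ 0)
  have h := torusE_carrierCl_le_of_carrierExpMoments hC hCE ((le_max_left _ _).trans hβ) ((le_max_right _ _).trans hβ) q x hq hR hRu hRL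
  linarith

/-- **The criterion in flat letters**: unboundedness of `β·⟨carrierCl 1 1 1 R q x⟩_{2L+1,β}` (bare weight times the β-free carrier mean) at every
physical size kills both bare-weighted binders at once. [folklore] -/
theorem not_gaussianDomination_and_not_carrierExpMoments_of_flatMean
    (hU : ∀ ℓ : ℝ, 0 < ℓ → ∀ M β₀ : ℝ, ∃ β : ℝ, β₀ ≤ β ∧ ∃ (L R : ℕ) (q : Fin 4 × Fin 4) (x : Fin 4 → ℤ),
      q.1 < q.2 ∧ 1 ≤ R ∧ (R : ℝ) * Transport.uRec β ≤ ℓ ∧ 4 * R + 8 ≤ L ∧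
      M < β * torusE (Matrix.specialUnitaryGroup (Fin 2) ℂ) (fundamentalLatticeRep 2) β L
        (carrierCl (fundamentalLatticeRep 2) 1 1 1 R q x)) :
    ¬ GaussianDominationSU2 ∧ ¬ CarrierExpMomentsSU2 := by
  have hU' : ∀ ℓ : ℝ, 0 < ℓ → ∀ M β₀ : ℝ, ∃ β : ℝ, β₀ ≤ β ∧ ∃ (L R : ℕ) (q : Fin 4 × Fin 4) (x : Fin 4 → ℤ),
      q.1 < q.2 ∧ 1 ≤ R ∧ (R : ℝ) * Transport.uRec β ≤ ℓ ∧ 4 * R + 8 ≤ L ∧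
      M < torusE (Matrix.specialUnitaryGroup (Fin 2) ℂ) (fundamentalLatticeRep 2) β L
        (carrierCl (fundamentalLatticeRep 2) 1 1 β R q x) := by
    intro ℓ hℓ M β₀
    obtain ⟨β, hβ, L, R, q, x, hq, hR, hRu, hRL, hM⟩ := hU ℓ hℓ M β₀
    refine ⟨β, hβ, L, R, q, x, hq, hR, hRu, hRL, ?_⟩
    rwa [carrierMean_eq_mul_flat]
  exact ⟨not_gaussianDominationSU2_of_carrierMean_unbounded hU', not_carrierExpMomentsSU2_of_carrierMean_unbounded hU'⟩

end Summit.QuantumFields.YangMills.Cruxes.UVSeamRec.ClassicalResponse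

end
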